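import Summits.KontsevichZagierPeriods.KontsevichZagierPeriods.Theorems.LinRedNormalFormArrangementNormalFormSeparateTwoMass

/-!
# The effective base of a literal Janus band datum is an open polyhedron (Fourier–Motzkin)

(Line `janus-bands`, crux `ArrangementNormalForm`, stub `stub_separateHigh`, part `HHKFM` of
the wall-invariant termwise-split lemma `separateThree_hHk`, any base dimension `B` with fibres.)
The literal domain of a Janus band datum is `fdom Y lo hi = {z | x ∈ Y, t ∈ cell lo hi (av x)}`
(part `Mass`); its projection to the base, the EFFECTIVE BASE
`{x ∈ Y | cell lo hi (av x) ≠ ∅}` (`basePt_image_fdom`), is again an open polyhedron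
`{∀ j, 0 < φ j x}` for finitely many real affine forms `φ j` (`exists_eff_forms`, registered as
`separateThreeHHK_fm`). Proof: FOURIER–MOTZKIN elimination of the fibre coordinates one at a
time from the strict affine system `{M j > 0} ∪ {t i − lo i > 0, hi i − t i > 0}` (`fm_step` for
one unknown, `exists_proj` by induction on the number of unknowns; systems are encoded as finite
sets of coefficient tuples). The wall invariant `hH` of the skeleton is known on the closure of
the literal domain; since the fibre mass vanishes off the effective base (`lmass_eq_zero`,
`fdom_eq_eff`), the local analysis runs over the effective base, and
`closure_image_basePt_subset` (compactness) transports `hH` to its closure.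
-/

noncomputable section

open Set MeasureTheory

namespace Summit.KontsevichZagierPeriods.ArrangementNormalForm.JanusBands

namespace SepHHK

open SepTwo

/-! ### One elimination step -/

/-- Choosing a real strictly between finitely many lower and upper bounds. -/
theorem exists_between_finsets (L U : Finset ℝ) (hLU : ∀ l ∈ L, ∀ u ∈ U, l < u) :
    ∃ s : ℝ, (∀ l ∈ L, l < s) ∧ ∀ u ∈ U, s < u := by
  by_cases hLn : L.Nonempty
  · by_cases hUn : U.Nonempty
    · have hlt : L.max' hLn < U.min' hUn := hLU _ (L.max'_mem hLn) _ (U.min'_mem hUn)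
      refine ⟨(L.max' hLn + U.min' hUn) / 2, fun l hl => ?_, fun u hu => ?_⟩
      · have := L.le_max' l hl; linarith
      · have := U.min'_le u hu; linarith
    · refine ⟨L.max' hLn + 1, fun l hl => ?_, fun u hu => absurd ⟨u, hu⟩ hUn⟩
      have := L.le_max' l hl; linarith
  · by_cases hUn : U.Nonempty
    · refine ⟨U.min' hUn - 1, fun l hl => absurd ⟨l, hl⟩ hLn, fun u hu => ?_⟩
      have := U.min'_le u hu; linarith
    · exact ⟨0, fun l hl => absurd ⟨l, hl⟩ hLn, fun u hu => absurd ⟨u, hu⟩ hUn⟩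

/-- **Fourier–Motzkin, one unknown.** A finite system of strict inequalities `0 < α f + β f · s`
in one real unknown `s` is solvable iff the constraints without `s` hold and every lower bound is
below every upper bound (written multiplicatively). -/
theorem fm_step {ι : Type*} (S : Finset ι) (α β : ι → ℝ) :
    (∃ s : ℝ, ∀ f ∈ S, 0 < α f + β f * s) ↔
      (∀ f ∈ S, β f = 0 → 0 < α f) ∧
        ∀ f ∈ S, ∀ g ∈ S, 0 < β f → β g < 0 → 0 < -β g * α f + β f * α g := by
  classical
  constructor
  · rintro ⟨s, hs⟩
    refine ⟨fun f hf h0 => by simpa [h0] using hs f hf, fun f hf g hg hβf hβg => ?_⟩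
    have h1 := hs f hf
    have h2 := hs g hg
    nlinarith [mul_pos (neg_pos.2 hβg) h1, mul_pos hβf h2]
  · rintro ⟨hzero, hpair⟩
    set L := (S.filter fun f => 0 < β f).image fun f => -α f / β f with hL
    set U := (S.filter fun g => β g < 0).image fun g => -α g / β g with hU
    have hLU : ∀ l ∈ L, ∀ u ∈ U, l < u := by
      intro l hl u hu
      obtain ⟨f, hf, rfl⟩ := Finset.mem_image.1 hl
      obtain ⟨g, hg, rfl⟩ := Finset.mem_image.1 hu
      obtain ⟨hfS, hβf⟩ := Finset.mem_filter.1 hf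
      obtain ⟨hgS, hβg⟩ := Finset.mem_filter.1 hg
      have h := hpair f hfS g hgS hβf hβg
      have hu' : -α g / β g = α g / (-β g) := by rw [neg_div, div_neg]
      rw [hu', div_lt_div_iff₀ hβf (neg_pos.2 hβg)]
      nlinarith
    obtain ⟨s, hsL, hsU⟩ := exists_between_finsets L U hLU
    refine ⟨s, fun f hf => ?_⟩
    rcases lt_trichotomy (β f) 0 with hβ | hβ | hβ
    · have hs : s < -α f / β f :=
        hsU _ (Finset.mem_image.2 ⟨f, Finset.mem_filter.2 ⟨hf, hβ⟩, rfl⟩)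
      have := (lt_div_iff_of_neg hβ).1 hs
      linarith
    · rw [hβ, zero_mul, add_zero]; exact hzero f hf hβ
    · have hs : -α f / β f < s :=
        hsL _ (Finset.mem_image.2 ⟨f, Finset.mem_filter.2 ⟨hf, hβ⟩, rfl⟩)
      have := (div_lt_iff₀ hβ).1 hs
      linarith

/-! ### Elimination of all unknowns -/

variable {n : ℕ}

/-- The value of a row `(a, b, c)` of a strict affine system on `ℝⁿ × ℝᵐ`:
`∑ aᵢ xᵢ + ∑ bₗ tₗ + c`. -/
def rowVal {m : ℕ} (f : (Fin n → ℝ) × (Fin m → ℝ) × ℝ) (x : Fin n → ℝ) (t : Fin m → ℝ) : ℝ :=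
  (∑ i, f.1 i * x i) + (∑ l, f.2.1 l * t l) + f.2.2

/-- **Projection of an open polyhedron is an open polyhedron.** For every finite strict affine
system on `ℝⁿ × ℝᵐ` there is a finite strict affine system on `ℝⁿ` describing the parameters
`x` for which the system in `t` is solvable. -/
theorem exists_proj (m : ℕ) : ∀ S : Finset ((Fin n → ℝ) × (Fin m → ℝ) × ℝ),
    ∃ S' : Finset ((Fin n → ℝ) × ℝ), ∀ x : Fin n → ℝ,
      (∃ t : Fin m → ℝ, ∀ f ∈ S, 0 < rowVal f x t) ↔ ∀ g ∈ S', 0 < (∑ i, g.1 i * x i) + g.2 := by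
  classical
  induction m with
  | zero =>
      intro S
      refine ⟨S.image fun f => (f.1, f.2.2), fun x => ⟨?_, fun h => ?_⟩⟩
      · rintro ⟨t, ht⟩ g hg
        obtain ⟨f, hf, rfl⟩ := Finset.mem_image.1 hg
        simpa [rowVal] using ht f hf
      · refine ⟨fun i => i.elim0, fun f hf => ?_⟩
        simpa [rowVal] using h (f.1, f.2.2) (Finset.mem_image_of_mem _ hf)
  | succ m ih =>
      intro S
      set β : ((Fin n → ℝ) × (Fin (m + 1) → ℝ) × ℝ) → ℝ := fun f => f.2.1 (Fin.last m) with hβ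
      set red : ((Fin n → ℝ) × (Fin (m + 1) → ℝ) × ℝ) → ((Fin n → ℝ) × (Fin m → ℝ) × ℝ) :=
        fun f => (f.1, fun l => f.2.1 (Fin.castSucc l), f.2.2) with hred
      set comb : ((Fin n → ℝ) × (Fin (m + 1) → ℝ) × ℝ) × ((Fin n → ℝ) × (Fin (m + 1) → ℝ) × ℝ) →
          ((Fin n → ℝ) × (Fin m → ℝ) × ℝ) := fun fg =>
        (fun i => -β fg.2 * fg.1.1 i + β fg.1 * fg.2.1 i,
          fun l => -β fg.2 * fg.1.2.1 (Fin.castSucc l) + β fg.1 * fg.2.2.1 (Fin.castSucc l),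
          -β fg.2 * fg.1.2.2 + β fg.1 * fg.2.2.2) with hcomb
      set S₁ : Finset ((Fin n → ℝ) × (Fin m → ℝ) × ℝ) :=
        ((S.filter fun f => β f = 0).image red) ∪
          (((S.filter fun f => 0 < β f) ×ˢ (S.filter fun g => β g < 0)).image comb) with hS₁
      obtain ⟨S', hS'⟩ := ih S₁
      refine ⟨S', fun x => ?_⟩
      rw [← hS' x]
      have hrow : ∀ f (t' : Fin m → ℝ) (s : ℝ),
          rowVal f x (Fin.snoc t' s) = rowVal (red f) x t' + β f * s := by
        intro f t' s
        simp only [rowVal, hred, hβ, Fin.sum_univ_castSucc, Fin.snoc_castSucc, Fin.snoc_last]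
        ring
      have hcombv : ∀ f g (t' : Fin m → ℝ), rowVal (comb (f, g)) x t' =
          -β g * rowVal (red f) x t' + β f * rowVal (red g) x t' := by
        intro f g t'
        have e1 : ∑ i, (-β g * f.1 i + β f * g.1 i) * x i =
            -β g * ∑ i, f.1 i * x i + β f * ∑ i, g.1 i * x i := by
          rw [Finset.mul_sum, Finset.mul_sum, ← Finset.sum_add_distrib]
          exact Finset.sum_congr rfl fun i _ => by ring
        have e2 : ∑ l : Fin m, (-β g * f.2.1 (Fin.castSucc l) + β f * g.2.1 (Fin.castSucc l)) * t' l =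
            -β g * ∑ l : Fin m, f.2.1 (Fin.castSucc l) * t' l +
              β f * ∑ l : Fin m, g.2.1 (Fin.castSucc l) * t' l := by
          rw [Finset.mul_sum, Finset.mul_sum, ← Finset.sum_add_distrib]
          exact Finset.sum_congr rfl fun l _ => by ring
        simp only [rowVal, hcomb, hred]
        rw [e1, e2]
        ring
      constructor
      · rintro ⟨t, ht⟩
        refine ⟨Fin.init t, ?_⟩
        have ht' : ∀ f ∈ S, 0 < rowVal (red f) x (Fin.init t) + β f * t (Fin.last m) := by
          intro f hf
          rw [← hrow, Fin.snoc_init_self]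
          exact ht f hf
        have key := (fm_step S (fun f => rowVal (red f) x (Fin.init t)) β).1 ⟨t (Fin.last m), ht'⟩
        intro g hg
        rcases Finset.mem_union.1 hg with hg | hg
        · obtain ⟨f, hf, rfl⟩ := Finset.mem_image.1 hg
          obtain ⟨hfS, hβ0⟩ := Finset.mem_filter.1 hf
          exact key.1 f hfS hβ0
        · obtain ⟨⟨f, g'⟩, hfg, rfl⟩ := Finset.mem_image.1 hg
          obtain ⟨hf, hg'⟩ := Finset.mem_product.1 hfg
          obtain ⟨hfS, hβf⟩ := Finset.mem_filter.1 hf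
          obtain ⟨hgS, hβg⟩ := Finset.mem_filter.1 hg'
          rw [hcombv]
          exact key.2 f hfS g' hgS hβf hβg
      · rintro ⟨t', ht'⟩
        have key := (fm_step S (fun f => rowVal (red f) x t') β).2 ⟨?_, ?_⟩
        · obtain ⟨s, hs⟩ := key
          exact ⟨Fin.snoc t' s, fun f hf => by rw [hrow]; exact hs f hf⟩
        · intro f hf hβ0
          exact ht' (red f) (Finset.mem_union_left _
            (Finset.mem_image_of_mem _ (Finset.mem_filter.2 ⟨hf, hβ0⟩)))
        · intro f hf g hg hβf hβg
          have h := ht' (comb (f, g)) (Finset.mem_union_right _ (Finset.mem_image_of_mem _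
            (Finset.mem_product.2 ⟨Finset.mem_filter.2 ⟨hf, hβf⟩, Finset.mem_filter.2 ⟨hg, hβg⟩⟩)))
          rwa [hcombv] at h

/-! ### The effective base -/

variable {B k m' : ℕ}

/-- The indicator vector of a fibre coordinate. -/
def ev (i : Fin k) : Fin k → ℝ := fun l => if l = i then 1 else 0

/-- Pairing with an indicator vector picks the coordinate. -/
theorem sum_ev_mul (i : Fin k) (t : Fin k → ℝ) : ∑ l, ev i l * t l = t i := by
  simp [ev]

/-- The row of the base letter `M j`. -/
def rowBase (M : Fin m' → Atm B) (j : Fin m') : (Fin B → ℝ) × (Fin k → ℝ) × ℝ :=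
  (fun i => ((M j).1 i : ℝ), fun _ => 0, ((M j).2 : ℝ))

/-- The row of the lower bound of the fibre coordinate `i`: `tᵢ − lo i > 0`. -/
def rowLo (lo : Fin k → Fin k ⊕ Atm B) (i : Fin k) : (Fin B → ℝ) × (Fin k → ℝ) × ℝ :=
  match lo i with
  | Sum.inl j => (fun _ => 0, ev i - ev j, 0)
  | Sum.inr c => (fun i' => -(c.1 i' : ℝ), ev i, -(c.2 : ℝ))

/-- The row of the upper bound of the fibre coordinate `i`: `hi i − tᵢ > 0`. -/
def rowHi (hi : Fin k → Fin k ⊕ Atm B) (i : Fin k) : (Fin B → ℝ) × (Fin k → ℝ) × ℝ :=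
  match hi i with
  | Sum.inl j => (fun _ => 0, ev j - ev i, 0)
  | Sum.inr c => (fun i' => (c.1 i' : ℝ), -ev i, (c.2 : ℝ))

/-- The base row evaluates to the letter. -/
theorem rowVal_rowBase (M : Fin m' → Atm B) (j : Fin m') (x : Fin B → ℝ) (t : Fin k → ℝ) :
    rowVal (rowBase M j) x t = av x (M j) := by
  simp [rowVal, rowBase, av]

/-- The lower row evaluates to `tᵢ − lo i`. -/
theorem rowVal_rowLo (lo : Fin k → Fin k ⊕ Atm B) (i : Fin k) (x : Fin B → ℝ) (t : Fin k → ℝ) :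
    rowVal (rowLo lo i) x t = t i - Sum.elim t (av x) (lo i) := by
  unfold rowLo
  cases h : lo i with
  | inl j =>
      simp only [rowVal, zero_mul, Finset.sum_const_zero, Pi.sub_apply, sub_mul,
        Finset.sum_sub_distrib, sum_ev_mul, Sum.elim_inl]
      ring
  | inr c =>
      simp only [rowVal, sum_ev_mul, Sum.elim_inr, av, neg_mul, Finset.sum_neg_distrib]
      ring

/-- The upper row evaluates to `hi i − tᵢ`. -/
theorem rowVal_rowHi (hi : Fin k → Fin k ⊕ Atm B) (i : Fin k) (x : Fin B → ℝ) (t : Fin k → ℝ) :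
    rowVal (rowHi hi i) x t = Sum.elim t (av x) (hi i) - t i := by
  unfold rowHi
  cases h : hi i with
  | inl j =>
      simp only [rowVal, zero_mul, Finset.sum_const_zero, Pi.sub_apply, sub_mul,
        Finset.sum_sub_distrib, sum_ev_mul, Sum.elim_inl]
      ring
  | inr c =>
      simp only [rowVal, Pi.neg_apply, neg_mul, Finset.sum_neg_distrib, sum_ev_mul, Sum.elim_inr, av]
      ring

/-- The full system of the literal domain. -/
def litSys (M : Fin m' → Atm B) (lo hi : Fin k → Fin k ⊕ Atm B) :
    Finset ((Fin B → ℝ) × (Fin k → ℝ) × ℝ) :=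
  (Finset.univ.image (rowBase (k := k) M) ∪ Finset.univ.image (rowLo lo)) ∪
    Finset.univ.image (rowHi hi)

/-- **The literal system describes the literal domain.** -/
theorem litSys_iff (M : Fin m' → Atm B) (lo hi : Fin k → Fin k ⊕ Atm B) (x : Fin B → ℝ)
    (t : Fin k → ℝ) :
    (∀ f ∈ litSys M lo hi, 0 < rowVal f x t) ↔ (∀ j, 0 < av x (M j)) ∧ t ∈ cell lo hi (av x) := by
  classical
  simp only [litSys, Finset.mem_union, Finset.mem_image, Finset.mem_univ, true_and, cell,
    mem_setOf_eq]
  constructor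
  · intro h
    refine ⟨fun j => ?_, fun i => ⟨?_, ?_⟩⟩
    · have := h _ (Or.inl (Or.inl ⟨j, rfl⟩))
      rwa [rowVal_rowBase] at this
    · have := h _ (Or.inl (Or.inr ⟨i, rfl⟩))
      rw [rowVal_rowLo] at this
      linarith
    · have := h _ (Or.inr ⟨i, rfl⟩)
      rw [rowVal_rowHi] at this
      linarith
  · rintro ⟨hM, hcell⟩ f hf
    rcases hf with (⟨j, rfl⟩ | ⟨i, rfl⟩) | ⟨i, rfl⟩
    · rw [rowVal_rowBase]; exact hM j
    · rw [rowVal_rowLo]; linarith [(hcell i).1]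
    · rw [rowVal_rowHi]; linarith [(hcell i).2]

/-- **The effective base is an open polyhedron.** See the module docstring. -/
theorem exists_eff_forms (M : Fin m' → Atm B) (lo hi : Fin k → Fin k ⊕ Atm B) :
    ∃ (m'' : ℕ) (φ : Fin m'' → (Fin B → ℝ) × ℝ), ∀ x : Fin B → ℝ,
      ((∀ j, 0 < av x (M j)) ∧ (cell lo hi (av x)).Nonempty) ↔
        ∀ j, 0 < (∑ i, (φ j).1 i * x i) + (φ j).2 := by
  classical
  obtain ⟨S', hS'⟩ := exists_proj k (litSys M lo hi)
  refine ⟨S'.card, fun j => ((S'.equivFin.symm j : S') : (Fin B → ℝ) × ℝ), fun x => ?_⟩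
  have h1 : ((∀ j, 0 < av x (M j)) ∧ (cell lo hi (av x)).Nonempty) ↔
      ∃ t : Fin k → ℝ, ∀ f ∈ litSys M lo hi, 0 < rowVal f x t := by
    constructor
    · rintro ⟨hM, t, ht⟩
      exact ⟨t, (litSys_iff M lo hi x t).2 ⟨hM, ht⟩⟩
    · rintro ⟨t, ht⟩
      obtain ⟨hM, hc⟩ := (litSys_iff M lo hi x t).1 ht
      exact ⟨hM, t, hc⟩
  rw [h1, hS' x]
  constructor
  · intro h j
    exact h _ (S'.equivFin.symm j).2
  · intro h g hg
    have := h (S'.equivFin ⟨g, hg⟩)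
    simpa using this

/-! ### The effective base and the literal domain -/

/-- The fibre mass vanishes where the cell is empty. -/
theorem lmass_eq_zero {ι : Type*} (lo hi : Fin k → Fin k ⊕ ι) (a : Fin k → Option ι) (α : ι → ℝ)
    (h : cell lo hi α = ∅) : lmass lo hi a α = 0 := by
  rw [lmass, h, Measure.restrict_empty, lintegral_zero_measure]

/-- The literal domain over `Y` equals the literal domain over the effective base. -/
theorem fdom_eq_eff (Y : Set (Fin B → ℝ)) (lo hi : Fin k → Fin k ⊕ Atm B) :
    fdom Y lo hi = fdom (Y ∩ {x | (cell lo hi (av x)).Nonempty}) lo hi := by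
  ext z
  simp only [fdom, mem_setOf_eq, mem_inter_iff]
  constructor
  · rintro ⟨hY, hc⟩; exact ⟨⟨hY, _, hc⟩, hc⟩
  · rintro ⟨⟨hY, -⟩, hc⟩; exact ⟨hY, hc⟩

/-- The base projection of the literal domain is the effective base. -/
theorem basePt_image_fdom (Y : Set (Fin B → ℝ)) (lo hi : Fin k → Fin k ⊕ Atm B) :
    basePt '' fdom Y lo hi = Y ∩ {x | (cell lo hi (av x)).Nonempty} := by
  ext x
  simp only [mem_image, fdom, mem_setOf_eq, mem_inter_iff]
  constructor
  · rintro ⟨z, ⟨hY, hc⟩, rfl⟩; exact ⟨hY, _, hc⟩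
  · rintro ⟨hY, t, ht⟩
    refine ⟨Fin.append x t, ⟨?_, ?_⟩, basePt_append x t⟩
    · rwa [basePt_append]
    · rwa [basePt_append, fibPt_append]

/-- **Closure of the base projection of a bounded set.** -/
theorem closure_image_basePt_subset {D : Set (Fin (B + k) → ℝ)} (hD : Bornology.IsBounded D) :
    closure (basePt '' D) ⊆ basePt '' closure D := by
  have hc : Continuous (basePt : (Fin (B + k) → ℝ) → Fin B → ℝ) :=
    continuous_pi fun i => continuous_apply _
  exact closure_minimal (image_mono subset_closure) ((hD.isCompact_closure.image hc).isClosed)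

end SepHHK

/-- **The effective base of a literal Janus band datum is an open polyhedron** (registered part
of `stub_separateHigh` with fibres; literal form of `SepHHK.exists_eff_forms`): the set of base
points of the open base polyhedron `{∀ j, 0 < M j}` over which the fibre cell is non-empty is
described by finitely many strict real affine inequalities (Fourier–Motzkin). -/
theorem separateThreeHHK_fm (B k m' : ℕ) (M : Fin m' → (Fin B → ℚ) × ℚ) (lo hi : Fin k → Fin k ⊕ ((Fin B → ℚ) × ℚ)) : ∃ (m'' : ℕ) (φ : Fin m'' → (Fin B → ℝ) × ℝ), ∀ x : Fin B → ℝ, ((∀ j, 0 < ∑ i, ((M j).1 i : ℝ) * x i + ((M j).2 : ℝ)) ∧ ∃ t : Fin k → ℝ, ∀ i, Sum.elim t (fun c : (Fin B → ℚ) × ℚ => ∑ i', (c.1 i' : ℝ) * x i' + (c.2 : ℝ)) (lo i) < t i ∧ t i < Sum.elim t (fun c : (Fin B → ℚ) × ℚ => ∑ i', (c.1 i' : ℝ) * x i' + (c.2 : ℝ)) (hi i)) ↔ ∀ j, 0 < (∑ i, (φ j).1 i * x i) + (φ j).2 := by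
  exact SepHHK.exists_eff_forms M lo hi

end Summit.KontsevichZagierPeriods.ArrangementNormalForm.JanusBands
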